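import Literature.MathematicalPhysics.QuantumLattice.HubbardUVSymbolFibreSampling
import Literature.MathematicalPhysics.QuantumLattice.HubbardScaleReport
import HarnessLib

/-!
# Periodisation through the CENTRED CHART of the Brillouin zone: a smooth symbol vanishing near the zone boundary becomes a
# smooth `2π`-periodic symbol with the same derivative bounds

Topic `MathematicalPhysics/QuantumLattice`; a companion of `HubbardUVSymbolFibreSampling` (k3c2-p1: mixed lattice differences
of a SAMPLED symbol `y ↦ Φ(p_y)` on the dual torus `(ℤ/L)²` are bounded by the Fréchet derivatives of a smooth `2π`-PERIODIC `Φ`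
on the Euclidean momentum plane, `norm_fwdDiff_iter₂_sample_le`) and of `HubbardScaleReport.torusCentredMomentum` (the centred
representative `c(k⃗) ∈ (-π,π]²` of a torus momentum).  The sector multipliers of Benfatto–Giuliani–Mastropietro 2006, §2.5
(2.45)–(2.48), carry the ANGULAR cutoff `ζ̃_{h,ω}(θ(c(k⃗)))` of the centred momentum, which is NOT a periodic smooth function of
the lattice momentum `p_y = 2πy/L`; but the multiplier vanishes near the zone boundary (the scale-`h` shell of the band stays
inside the zone, `HubbardScaleZeroSectorSymbolGeometry`).  This file supplies the generic bridge:

* `zoneCentred p` — the coordinatewise reduction of a plane momentum into `(-π,π]²` (`toIocMod`);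
  `torusCentredMomentum L k = zoneCentred (latticeMomentum L k)` (`rfl`), `zoneCentred_add_zsmul` (`2πℤ²`-invariance),
  `eventually_zoneCentred_eq_sub` (off the zone boundary the chart is locally a translation by `2πz`),
  `eventually_abs_zoneCentred_gt` (at the boundary it stays near the boundary);
* `zonePeriodise Ψ = Ψ ∘ c` on the Euclidean plane and, for `Ψ ∈ Cⁿ` with `Ψ(x) = 0` whenever some `|x_i| ≥ π − δ`:
  **`contDiff_zonePeriodise`**, **`norm_iteratedFDeriv_zonePeriodise_le`** (`‖Dⁱ(Ψ∘c)‖ ≤ sup‖DⁱΨ‖`), `zonePeriodise_periodic`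
  (the `PlanePeriodic` hypothesis of the sampling lemmas), `zonePeriodise_latticeMomentum` (its samples are `Ψ(c(k⃗))`).

Everything is proved; `zoneCentred`, `zonePeriodise` are the only definitions; no named facts.

## Sources

G. Benfatto, A. Giuliani, V. Mastropietro, Ann. Henri Poincaré 7 (2006) 809–898, §2.1 (2.3), §2.5 (2.45)–(2.48), (2.36aa)
(`BenfattoGiulianiMastropietro2006`).
-/

noncomputable section

namespace Literature.MathematicalPhysics.QuantumLattice

open Real Set Filter Literature.Probability.LatticeModels
open scoped Topology

/-! ### §1 The centred chart -/

/-- **The centred chart of the Brillouin zone**: coordinatewise reduction of a plane momentum into `(-π,π]²`.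
[cite: BenfattoGiulianiMastropietro2006, §2.5 (2.45)] -/
def zoneCentred (p : Fin 2 → ℝ) : Fin 2 → ℝ := fun i => toIocMod Real.two_pi_pos (-π) (p i)

/-- Unfolding. [cite: BenfattoGiulianiMastropietro2006, §2.5 (2.45)] -/
theorem zoneCentred_apply (p : Fin 2 → ℝ) (i : Fin 2) : zoneCentred p i = toIocMod Real.two_pi_pos (-π) (p i) := rfl

/-- The centred torus momentum is the centred chart of the lattice momentum. [cite: BenfattoGiulianiMastropietro2006, §2.5 (2.45)] -/
theorem torusCentredMomentum_eq_zoneCentred {L : ℕ} (k : TorusSite 2 L) :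
    torusCentredMomentum L k = zoneCentred (latticeMomentum L k) := rfl

/-- The chart lands in `(-π,π]`. [cite: BenfattoGiulianiMastropietro2006, §2.5 (2.45)] -/
theorem zoneCentred_mem_Ioc (p : Fin 2 → ℝ) (i : Fin 2) : zoneCentred p i ∈ Ioc (-π) π := by
  have h := toIocMod_mem_Ioc Real.two_pi_pos (-π) (p i)
  rw [show -π + 2 * π = π by ring] at h
  exact h

/-- `|c(p)_i| ≤ π`. [cite: BenfattoGiulianiMastropietro2006, §2.5 (2.45)] -/
theorem abs_zoneCentred_le (p : Fin 2 → ℝ) (i : Fin 2) : |zoneCentred p i| ≤ π :=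
  abs_le.2 ⟨(zoneCentred_mem_Ioc p i).1.le, (zoneCentred_mem_Ioc p i).2⟩

/-- The chart is `2πℤ²`-invariant. [cite: BenfattoGiulianiMastropietro2006, §2.1 (2.3)] -/
theorem zoneCentred_add_zsmul (p : Fin 2 → ℝ) (z : Fin 2 → ℤ) :
    zoneCentred (fun i => p i + z i * (2 * π)) = zoneCentred p := by
  funext i
  rw [zoneCentred_apply, zoneCentred_apply, ← zsmul_eq_mul]
  exact toIocMod_add_zsmul _ _ _ _

/-- The chart is a translation by a lattice vector (depending on the point). [cite: BenfattoGiulianiMastropietro2006, §2.5 (2.45)] -/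
theorem zoneCentred_eq_sub_zsmul (p : Fin 2 → ℝ) :
    zoneCentred p = fun i => p i - (toIocDiv Real.two_pi_pos (-π) (p i) : ℝ) * (2 * π) := by
  funext i
  rw [zoneCentred_apply, ← self_sub_toIocDiv_zsmul, zsmul_eq_mul]

/-- A point of `(-π,π]²` is its own chart. [cite: BenfattoGiulianiMastropietro2006, §2.5 (2.45)] -/
theorem zoneCentred_eq_self {p : Fin 2 → ℝ} (hp : ∀ i, p i ∈ Ioc (-π) π) : zoneCentred p = p := by
  funext i
  rw [zoneCentred_apply, toIocMod_eq_self, show -π + 2 * π = π by ring]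
  exact hp i

/-- **Off the zone boundary the chart is locally a translation**: if no coordinate of `c(p)` equals `π`, there is `z ∈ ℤ²` with
`c(p′) = p′ − 2πz` for all `p′` near `p`. [cite: BenfattoGiulianiMastropietro2006, §2.5 (2.45)] -/
theorem eventually_zoneCentred_eq_sub {p : Fin 2 → ℝ} (hp : ∀ i, zoneCentred p i ≠ π) :
    ∃ z : Fin 2 → ℤ, ∀ᶠ p' in 𝓝 p, zoneCentred p' = fun i => p' i - (z i : ℝ) * (2 * π) := by
  refine ⟨fun i => toIocDiv Real.two_pi_pos (-π) (p i), ?_⟩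
  have hopen : ∀ i, ∀ᶠ p' : Fin 2 → ℝ in 𝓝 p,
      p' i - (toIocDiv Real.two_pi_pos (-π) (p i) : ℝ) * (2 * π) ∈ Ioo (-π) π := by
    intro i
    have hmem : p i - (toIocDiv Real.two_pi_pos (-π) (p i) : ℝ) * (2 * π) ∈ Ioo (-π) π := by
      have h1 := zoneCentred_mem_Ioc p i
      have h2 := hp i
      rw [zoneCentred_eq_sub_zsmul] at h1 h2
      exact ⟨h1.1, lt_of_le_of_ne h1.2 h2⟩
    exact (((continuous_apply i).sub continuous_const).continuousAt (x := p)).eventually_mem (isOpen_Ioo.mem_nhds hmem)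
  filter_upwards [eventually_all.2 hopen] with p' h'
  funext i
  rw [zoneCentred_apply, ← self_sub_toIocDiv_zsmul, zsmul_eq_mul]
  congr 2
  refine congrArg (fun z : ℤ => (z : ℝ)) (toIocDiv_eq_of_sub_zsmul_mem_Ioc _ ?_)
  rw [zsmul_eq_mul, show -π + 2 * π = π by ring]
  exact Ioo_subset_Ioc_self (h' i)

/-- **At the zone boundary the chart stays near the boundary**: if `c(p)_i = π` then `|c(p′)_i| > π − δ` for `p′` near `p`.
[cite: BenfattoGiulianiMastropietro2006, §2.5 (2.45)] -/
theorem eventually_abs_zoneCentred_gt {p : Fin 2 → ℝ} {i : Fin 2} (hp : zoneCentred p i = π) {δ : ℝ} (hδ : 0 < δ) :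
    ∀ᶠ p' in 𝓝 p, π - δ < |zoneCentred p' i| := by
  set z : ℤ := toIocDiv Real.two_pi_pos (-π) (p i) with hz
  have hpz : p i - (z : ℝ) * (2 * π) = π := by
    have h := congrFun (zoneCentred_eq_sub_zsmul p) i
    rw [hp] at h
    exact h.symm
  set m : ℝ := min δ π with hm
  have hm0 : 0 < m := lt_min hδ pi_pos
  have hmδ : m ≤ δ := min_le_left _ _
  have hmπ : m ≤ π := min_le_right _ _
  have hev : ∀ᶠ p' : Fin 2 → ℝ in 𝓝 p, p' i ∈ Ioo (p i - m) (p i + m) :=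
    ((continuous_apply i).continuousAt (x := p)).eventually_mem (Ioo_mem_nhds (by linarith) (by linarith))
  filter_upwards [hev] with p' h'
  obtain ⟨h1, h2⟩ := h'
  rw [zoneCentred_apply]
  by_cases ht : p' i - (z : ℝ) * (2 * π) ≤ π
  · -- no wrap: `c(p')_i = p'_i - 2πz ∈ (π - m, π]`
    have heq : toIocMod Real.two_pi_pos (-π) (p' i) = p' i - (z : ℝ) * (2 * π) := by
      refine (toIocMod_eq_iff _).2 ⟨⟨by linarith, by linarith⟩, z, ?_⟩
      rw [zsmul_eq_mul]; ring
    rw [heq]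
    exact lt_of_lt_of_le (by linarith) (le_abs_self _)
  · -- wrap: `c(p')_i = p'_i - 2π(z+1) ∈ (-π, -π + m)`
    push Not at ht
    have heq : toIocMod Real.two_pi_pos (-π) (p' i) = p' i - ((z : ℝ) + 1) * (2 * π) := by
      refine (toIocMod_eq_iff _).2 ⟨⟨by linarith, by linarith⟩, z + 1, ?_⟩
      rw [zsmul_eq_mul]; push_cast; ring
    rw [heq]
    exact lt_of_lt_of_le (by linarith) (neg_le_abs _)

/-! ### §2 Periodisation of a symbol vanishing near the zone boundary -/

section Periodise

variable {F : Type*}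

/-- **The periodised symbol** `Ψ ∘ c` on the Euclidean momentum plane. [cite: BenfattoGiulianiMastropietro2006, §2.5 (2.45)–(2.48)] -/
def zonePeriodise (Ψ : EuclideanSpace ℝ (Fin 2) → F) (x : EuclideanSpace ℝ (Fin 2)) : F :=
  Ψ (WithLp.toLp 2 (zoneCentred (WithLp.ofLp x)))

/-- Unfolding. [cite: BenfattoGiulianiMastropietro2006, §2.5 (2.45)] -/
theorem zonePeriodise_apply (Ψ : EuclideanSpace ℝ (Fin 2) → F) (x : EuclideanSpace ℝ (Fin 2)) :
    zonePeriodise Ψ x = Ψ (WithLp.toLp 2 (zoneCentred (WithLp.ofLp x))) := rfl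

/-- **The periodised symbol is `2π`-periodic in both coordinates** (the `PlanePeriodic` hypothesis of the sampling lemmas).
[cite: BenfattoGiulianiMastropietro2006, §2.1 (2.3)] -/
theorem zonePeriodise_periodic (Ψ : EuclideanSpace ℝ (Fin 2) → F) (p : Fin 2 → ℝ) (z : Fin 2 → ℤ) :
    zonePeriodise Ψ (WithLp.toLp 2 (fun i => p i + z i * (2 * π))) = zonePeriodise Ψ (WithLp.toLp 2 p) := by
  simp only [zonePeriodise_apply, zoneCentred_add_zsmul]

/-- **Its lattice samples are the values at the centred momenta**: `(Ψ∘c)(p_y) = Ψ(c(k⃗_y))`.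
[cite: BenfattoGiulianiMastropietro2006, §2.5 (2.45)] -/
theorem zonePeriodise_latticeMomentum {L : ℕ} (Ψ : EuclideanSpace ℝ (Fin 2) → F) (y : TorusSite 2 L) :
    zonePeriodise Ψ (WithLp.toLp 2 (latticeMomentum L y)) = Ψ (WithLp.toLp 2 (torusCentredMomentum L y)) := rfl

/-- On the zone `(-π,π]²` the periodised symbol is the symbol. [cite: BenfattoGiulianiMastropietro2006, §2.5 (2.45)] -/
theorem zonePeriodise_eq_of_mem (Ψ : EuclideanSpace ℝ (Fin 2) → F) {x : EuclideanSpace ℝ (Fin 2)}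
    (hx : ∀ i, x i ∈ Ioc (-π) π) : zonePeriodise Ψ x = Ψ x := by
  rw [zonePeriodise_apply, zoneCentred_eq_self (p := WithLp.ofLp x) hx, WithLp.toLp_ofLp]

/-- `PlanePeriodic` form. [cite: BenfattoGiulianiMastropietro2006, §2.1 (2.3)] -/
theorem planePeriodic_zonePeriodise (Ψ : EuclideanSpace ℝ (Fin 2) → F) :
    PlanePeriodic (fun p : Fin 2 → ℝ => zonePeriodise Ψ (WithLp.toLp 2 p)) :=
  fun p z => zonePeriodise_periodic Ψ p z

section Alg

variable [AddCommGroup F]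

/-- The local alternative behind smoothness: near every point, `Ψ ∘ c` is either a translate of `Ψ` or identically zero, when
`Ψ` vanishes on the strip `{∃ i, |x_i| ≥ π − δ}`. [cite: BenfattoGiulianiMastropietro2006, §2.5 (2.45)–(2.48)] -/
theorem zonePeriodise_eventuallyEq (Ψ : EuclideanSpace ℝ (Fin 2) → F) {δ : ℝ} (hδ : 0 < δ)
    (h0 : ∀ x : EuclideanSpace ℝ (Fin 2), (∃ i, π - δ ≤ |x i|) → Ψ x = 0) (x : EuclideanSpace ℝ (Fin 2)) :
    (∃ a : EuclideanSpace ℝ (Fin 2), (zonePeriodise Ψ =ᶠ[𝓝 x] fun x' => Ψ (x' + a)) ∧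
        WithLp.toLp 2 (zoneCentred (WithLp.ofLp x)) = x + a) ∨
      ((zonePeriodise Ψ =ᶠ[𝓝 x] fun _ => 0) ∧ Ψ =ᶠ[𝓝 (WithLp.toLp 2 (zoneCentred (WithLp.ofLp x)))] fun _ => 0) := by
  have hcont : ContinuousAt (fun x' : EuclideanSpace ℝ (Fin 2) => WithLp.ofLp x') x :=
    (PiLp.continuous_ofLp 2 _).continuousAt
  by_cases hb : ∀ i, zoneCentred (WithLp.ofLp x) i ≠ π
  · -- off the boundary: a translation
    left
    obtain ⟨z, hz⟩ := eventually_zoneCentred_eq_sub hb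
    refine ⟨-WithLp.toLp 2 (fun i => (z i : ℝ) * (2 * π)), ?_, ?_⟩
    · filter_upwards [hcont.eventually hz] with x' hx'
      rw [zonePeriodise_apply, hx', ← sub_eq_add_neg, ← WithLp.toLp_sub]
      rfl
    · rw [hz.self_of_nhds, ← sub_eq_add_neg, ← WithLp.toLp_sub]
      rfl
  · -- at the boundary: zero
    right
    push Not at hb
    obtain ⟨i, hi⟩ := hb
    constructor
    · filter_upwards [hcont.eventually (eventually_abs_zoneCentred_gt hi hδ)] with x' hx'
      exact h0 _ ⟨i, by simpa only [PiLp.toLp_apply] using hx'.le⟩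
    · -- `Ψ` vanishes on the open strip around the image point
      have hstrip : ∀ᶠ x' : EuclideanSpace ℝ (Fin 2) in 𝓝 (WithLp.toLp 2 (zoneCentred (WithLp.ofLp x))), π - δ < |x' i| := by
        have hc : ContinuousAt (fun x' : EuclideanSpace ℝ (Fin 2) => |x' i|) (WithLp.toLp 2 (zoneCentred (WithLp.ofLp x))) :=
          ((PiLp.continuous_apply 2 _ i).abs).continuousAt
        refine hc.eventually_mem (isOpen_Ioi.mem_nhds ?_)
        show π - δ < |(WithLp.toLp 2 (zoneCentred (WithLp.ofLp x)) : EuclideanSpace ℝ (Fin 2)) i|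
        rw [PiLp.toLp_apply, hi, abs_of_pos pi_pos]
        linarith
      filter_upwards [hstrip] with x' hx'
      exact h0 x' ⟨i, hx'.le⟩

end Alg

section Smooth

variable [NormedAddCommGroup F] [NormedSpace ℝ F]

/-- **The periodised symbol is smooth** when `Ψ ∈ Cⁿ` vanishes on the strip `{∃ i, |x_i| ≥ π − δ}` (`δ > 0`).
[cite: BenfattoGiulianiMastropietro2006, §2.5 (2.45)–(2.48)] -/
theorem contDiff_zonePeriodise {n : ℕ∞} {Ψ : EuclideanSpace ℝ (Fin 2) → F} (hΨ : ContDiff ℝ n Ψ) {δ : ℝ} (hδ : 0 < δ)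
    (h0 : ∀ x : EuclideanSpace ℝ (Fin 2), (∃ i, π - δ ≤ |x i|) → Ψ x = 0) : ContDiff ℝ n (zonePeriodise Ψ) := by
  refine contDiff_iff_contDiffAt.2 fun x => ?_
  rcases zonePeriodise_eventuallyEq Ψ hδ h0 x with ⟨a, ha, -⟩ | ⟨h1, -⟩
  · exact ((hΨ.comp (contDiff_id.add contDiff_const)).contDiffAt).congr_of_eventuallyEq ha
  · exact (contDiff_const.contDiffAt).congr_of_eventuallyEq h1

/-- **The periodised symbol has the same derivative bounds**: `‖Dⁱ(Ψ∘c)(x)‖ ≤ W` whenever `‖DⁱΨ‖ ≤ W` everywhere.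
[cite: BenfattoGiulianiMastropietro2006, (2.36aa)] -/
theorem norm_iteratedFDeriv_zonePeriodise_le {i : ℕ} {Ψ : EuclideanSpace ℝ (Fin 2) → F} {δ : ℝ} (hδ : 0 < δ)
    (h0 : ∀ x : EuclideanSpace ℝ (Fin 2), (∃ i, π - δ ≤ |x i|) → Ψ x = 0) {W : ℝ}
    (hW : ∀ x, ‖iteratedFDeriv ℝ i Ψ x‖ ≤ W) (x : EuclideanSpace ℝ (Fin 2)) :
    ‖iteratedFDeriv ℝ i (zonePeriodise Ψ) x‖ ≤ W := by
  rcases zonePeriodise_eventuallyEq Ψ hδ h0 x with ⟨a, ha, -⟩ | ⟨h1, -⟩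
  · rw [(ha.iteratedFDeriv ℝ i).eq_of_nhds, iteratedFDeriv_comp_add_right]
    exact hW _
  · rw [(h1.iteratedFDeriv ℝ i).eq_of_nhds, iteratedFDeriv_fun_zero, Pi.zero_apply, norm_zero]
    exact (norm_nonneg _).trans (hW 0)

/-- The pointwise identity of derivatives: `Dⁱ(Ψ∘c)(x) = DⁱΨ(c(x))` (`Ψ ∈ Cⁱ` vanishing on the strip).
[cite: BenfattoGiulianiMastropietro2006, (2.36aa)] -/
theorem iteratedFDeriv_zonePeriodise (i : ℕ) (Ψ : EuclideanSpace ℝ (Fin 2) → F) {δ : ℝ} (hδ : 0 < δ)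
    (h0 : ∀ x : EuclideanSpace ℝ (Fin 2), (∃ i, π - δ ≤ |x i|) → Ψ x = 0) (x : EuclideanSpace ℝ (Fin 2)) :
    iteratedFDeriv ℝ i (zonePeriodise Ψ) x = iteratedFDeriv ℝ i Ψ (WithLp.toLp 2 (zoneCentred (WithLp.ofLp x))) := by
  rcases zonePeriodise_eventuallyEq Ψ hδ h0 x with ⟨a, ha, hxa⟩ | ⟨h1, h2⟩
  · rw [(ha.iteratedFDeriv ℝ i).eq_of_nhds, iteratedFDeriv_comp_add_right, hxa]
  · rw [(h1.iteratedFDeriv ℝ i).eq_of_nhds, (h2.iteratedFDeriv ℝ i).eq_of_nhds, iteratedFDeriv_fun_zero, Pi.zero_apply,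
      Pi.zero_apply]

end Smooth

end Periodise

end Literature.MathematicalPhysics.QuantumLattice
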